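import Summits.QuantumFields.YangMills.Theorems.PoincareLipschitzSphereMapTentSupport

/-!
# Line «poincare_lipschitz» on crux `HistoryTailL` (stmt-QuantumFields-19936), route crux `BlockLipschitzL` (stmt-QuantumFields-23533), K2 organ of record LOC-REG-MIN —
# FLAT SHADOW «ENERGY → RANGE» (E→R) FOR LATTICE MINIMISERS INTO A SPHERE, FILE 5d-F2: DYADIC DEPTH BANDS — the region `U = Q_{r′−1}(z) ∖ Q_{r′−2^{n+1}}(z)` is covered by the
# bands `Q_{r′−2^k}(z) ∖ Q_{r′−2^{k+2}}(z)`, `k ≤ n` (so `E_U ≤ Σ_k E(band_k)`), and the outer-slope mollifier box `Q_{⌊t∕4⌋}(y)` (`t = r′ − ‖y−z‖_∞ ≥ 4`) sits inside ONE band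
# `k` with `2^k ≤ 2(2⌊t∕4⌋ + 1)` and `2^k < t` — the two sockets by which px8's multi-scale good shell ✓`exists_goodRadius_dyadic` feeds ✓`oneStep_tent`

Cell `ym3-torus` (YM ladder rung R3 = continuum SU(2) Yang–Mills on the three-torus — a RUNG, NOT the Clay problem: not d = 4, not infinite volume, not a mass gap); width seat
`ym-ust-19936-w5` gen 12 (LEAD ym-ust-19936-w1 g8 2026-08-29T05:29:02Z END-GAME «[C] = E→R F5 (★w5) + F6 (px8)»; my LOCATE `E2R-ROAD-w5g12.md` §2 (i)(iii)).  THEOREMS ONLY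
(def-free), lattice letters of lit ✓`B4Eq19LatticeOperators`; uses ★w5 g12's ✓F5a sup-distance letters; `--supports stmt-QuantumFields-19936`.  Nothing here proves px8's `hone`,
E→R, LOC-REG-MIN, `hReg`, `hImprove`, a stub, `BlockLipschitzL`, `HistoryTailL` or a summit statement.
* §1 `exists_band_of_mem_U` (`y ∈ U ⇒ ∃ k ≤ n, y ∈ band_k`, `k = log₂ (r′ − ‖y−z‖_∞)`), ★★ `sum_U_le_sum_bands` (`Σ_U c ≤ Σ_{k≤n} Σ_{band_k} c` for `c ≥ 0`);
* §2 ★★ `box_outerRadius_subset_band` (`t = r′ − ‖y−z‖_∞ ≥ 4`, `s′ = ⌊t∕4⌋` ⇒ `∃ k, Q_{s′}(y) ⊆ band_k ∧ 2^k ≤ 2(2s′+1) ∧ 2^k < t`), `energy_box_outerRadius_le`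
  (hence `E(u; Q_{s′}(y)) ≤ E(u; band_k)`).
[folklore] ([SchoenUhlenbeck1982] §4 — in `d = 3` the energies of thin boundary shells are scale-free small; the lattice statements are this file's).
-/

set_option autoImplicit false

noncomputable section

open scoped BigOperators
open Finset

namespace Summit.QuantumFields.YangMills.Theorems.PoincareLipschitzSphereMapBandSuppliers

open Literature.MathematicalPhysics.QuantumFieldTheory.Balaban1983to89
open B4Eq19LatticeOperators
open Summit.QuantumFields.YangMills.Theorems.PoincareLipschitzSphereMapDepthRadius (mem_box_iff_sup_le abs_sup_sub_sup_le_of_mem_box)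

variable {d : ℕ}

/-! ## §1 The band cover of `U` -/

/-- `y ∈ Q_{r′−1}(z) ∖ Q_{r′−2^{n+1}}(z)` ⟹ `y ∈ Q_{r′−2^k}(z) ∖ Q_{r′−2^{k+2}}(z)` for `k = log₂(r′ − ‖y−z‖_∞) ≤ n` (`d ≥ 1`). [folklore] -/
theorem exists_band_of_mem_U (hd : 0 < d) (z : Zd d) (r' : ℤ) (n : ℕ) {y : Zd d}
    (hy : y ∈ box z (r' - 1) \ box z (r' - (2 : ℤ) ^ (n + 1))) :
    ∃ k, k ≤ n ∧ y ∈ box z (r' - (2 : ℤ) ^ k) \ box z (r' - (2 : ℤ) ^ (k + 2)) := by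
  classical
  set D : ℤ := ((Finset.univ.sup fun j => (y j - z j).natAbs : ℕ) : ℤ) with hD
  rw [Finset.mem_sdiff, mem_box_iff_sup_le hd, mem_box_iff_sup_le hd] at hy
  change D ≤ r' - 1 ∧ ¬ D ≤ r' - (2 : ℤ) ^ (n + 1) at hy
  obtain ⟨h1, h2⟩ := hy
  push Not at h2
  set t : ℕ := (r' - D).toNat with ht
  have ht1 : (t : ℤ) = r' - D := Int.toNat_of_nonneg (by linarith)
  have htpos : t ≠ 0 := by intro h0; rw [h0] at ht1; push_cast at ht1; linarith
  set k := Nat.log 2 t with hk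
  have hk1 : 2 ^ k ≤ t := Nat.pow_log_le_self 2 htpos
  have hk2 : t < 2 ^ (k + 1) := Nat.lt_pow_succ_log_self (by norm_num) t
  have h2n : (2 : ℤ) ^ (n + 1) = ((2 ^ (n + 1) : ℕ) : ℤ) := by push_cast; ring
  have htn : t < 2 ^ (n + 1) := by
    have : (t : ℤ) < (2 : ℤ) ^ (n + 1) := by linarith
    rw [h2n] at this; exact_mod_cast this
  have hkn : k ≤ n := by
    have : 2 ^ k < 2 ^ (n + 1) := lt_of_le_of_lt hk1 htn
    have := (Nat.pow_lt_pow_iff_right (by norm_num : 1 < 2)).1 this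
    omega
  refine ⟨k, hkn, ?_⟩
  rw [Finset.mem_sdiff, mem_box_iff_sup_le hd, mem_box_iff_sup_le hd]
  change D ≤ r' - (2 : ℤ) ^ k ∧ ¬ D ≤ r' - (2 : ℤ) ^ (k + 2)
  have e1 : (2 : ℤ) ^ k = ((2 ^ k : ℕ) : ℤ) := by push_cast; ring
  have e2 : (2 : ℤ) ^ (k + 2) = ((2 ^ (k + 2) : ℕ) : ℤ) := by push_cast; ring
  have hk1' : ((2 ^ k : ℕ) : ℤ) ≤ t := by exact_mod_cast hk1
  have hk2' : (t : ℤ) < ((2 ^ (k + 1) : ℕ) : ℤ) := by exact_mod_cast hk2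
  have hpow : ((2 ^ (k + 1) : ℕ) : ℤ) ≤ ((2 ^ (k + 2) : ℕ) : ℤ) := by exact_mod_cast Nat.pow_le_pow_right (by norm_num) (by omega)
  rw [e1, e2]
  constructor <;> omega

/-- ★★ **THE BAND COVER**: for `c ≥ 0` and `d ≥ 1`,
`Σ_{y ∈ Q_{r′−1}(z) ∖ Q_{r′−2^{n+1}}(z)} c y ≤ Σ_{k ∈ range (n+1)} Σ_{y ∈ Q_{r′−2^k}(z) ∖ Q_{r′−2^{k+2}}(z)} c y`. [folklore] -/
theorem sum_U_le_sum_bands (hd : 0 < d) (z : Zd d) (r' : ℤ) (n : ℕ) (c : Zd d → ℝ) (hc : ∀ y, 0 ≤ c y) :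
    ∑ y ∈ box z (r' - 1) \ box z (r' - (2 : ℤ) ^ (n + 1)), c y ≤
      ∑ k ∈ Finset.range (n + 1), ∑ y ∈ box z (r' - (2 : ℤ) ^ k) \ box z (r' - (2 : ℤ) ^ (k + 2)), c y := by
  classical
  set U := box z (r' - 1) \ box z (r' - (2 : ℤ) ^ (n + 1)) with hU
  set B : ℕ → Finset (Zd d) := fun k => box z (r' - (2 : ℤ) ^ k) \ box z (r' - (2 : ℤ) ^ (k + 2)) with hB
  -- pointwise: `c y ≤ Σ_k [y ∈ B k] c y`
  have h1 : ∀ y ∈ U, c y ≤ ∑ k ∈ Finset.range (n + 1), (if y ∈ B k then c y else 0) := by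
    intro y hy
    obtain ⟨k, hkn, hyk⟩ := exists_band_of_mem_U hd z r' n hy
    have hk : k ∈ Finset.range (n + 1) := Finset.mem_range.2 (by omega)
    have := Finset.single_le_sum (f := fun k' => if y ∈ B k' then c y else 0) (fun k' _ => by split_ifs <;> simp [hc y]) hk
    simp only [hB] at this ⊢
    rw [if_pos hyk] at this
    exact this
  calc ∑ y ∈ U, c y ≤ ∑ y ∈ U, ∑ k ∈ Finset.range (n + 1), (if y ∈ B k then c y else 0) := Finset.sum_le_sum h1
    _ = ∑ k ∈ Finset.range (n + 1), ∑ y ∈ U, (if y ∈ B k then c y else 0) := Finset.sum_comm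
    _ ≤ ∑ k ∈ Finset.range (n + 1), ∑ y ∈ B k, c y := by
        refine Finset.sum_le_sum fun k _ => ?_
        rw [← Finset.sum_filter]
        refine Finset.sum_le_sum_of_subset_of_nonneg (fun y hy => (Finset.mem_filter.1 hy).2) fun y _ _ => hc y

/-! ## §2 The outer-slope mollifier box sits in one band -/

/-- ★★ **ONE BAND HOLDS THE OUTER-SLOPE MOLLIFIER BOX**: `d ≥ 1`, `t := r′ − ‖y − z‖_∞ ≥ 4`, `s′ := ⌊t∕4⌋` ⟹ there is `k` with
`Q_{s′}(y) ⊆ Q_{r′−2^k}(z) ∖ Q_{r′−2^{k+2}}(z)`, `2^k ≤ 2·(2s′+1)` and `2^k < t` (`k = log₂⌊3t∕4⌋`). [folklore] -/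
theorem box_outerRadius_subset_band (hd : 0 < d) (z : Zd d) (r' : ℤ) (y : Zd d)
    (ht : 4 ≤ r' - ((Finset.univ.sup fun j => (y j - z j).natAbs : ℕ) : ℤ)) :
    ∃ k : ℕ, box y ((((r' - ((Finset.univ.sup fun j => (y j - z j).natAbs : ℕ) : ℤ)).toNat / 4 : ℕ) : ℤ)) ⊆
        box z (r' - (2 : ℤ) ^ k) \ box z (r' - (2 : ℤ) ^ (k + 2)) ∧
      ((2 ^ k : ℕ) : ℤ) ≤ 2 * (2 * (((r' - ((Finset.univ.sup fun j => (y j - z j).natAbs : ℕ) : ℤ)).toNat / 4 : ℕ) : ℤ) + 1) ∧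
      ((2 ^ k : ℕ) : ℤ) < r' - ((Finset.univ.sup fun j => (y j - z j).natAbs : ℕ) : ℤ) := by
  classical
  set D : ℤ := ((Finset.univ.sup fun j => (y j - z j).natAbs : ℕ) : ℤ) with hD
  set t : ℕ := (r' - D).toNat with htn
  have ht1 : (t : ℤ) = r' - D := Int.toNat_of_nonneg (by linarith)
  set s' : ℕ := t / 4 with hs'
  set m : ℕ := 3 * t / 4 with hm
  have hm0 : m ≠ 0 := by omega
  set k := Nat.log 2 m with hk
  have hk1 : 2 ^ k ≤ m := Nat.pow_log_le_self 2 hm0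
  have hk2 : m < 2 ^ (k + 1) := Nat.lt_pow_succ_log_self (by norm_num) m
  -- nat-division facts
  have hs'1 : 4 * s' ≤ t := by omega
  have hs'2 : t < 4 * s' + 4 := by omega
  have hm1 : 4 * m ≤ 3 * t := by omega
  have hm2 : 3 * t < 4 * m + 4 := by omega
  refine ⟨k, ?_, ?_, ?_⟩
  · intro y' hy'
    have h := abs_sup_sub_sup_le_of_mem_box hd z hy'
    change |D - ((Finset.univ.sup fun j => (y' j - z j).natAbs : ℕ) : ℤ)| ≤ ((s' : ℕ) : ℤ) at h
    set D' : ℤ := ((Finset.univ.sup fun j => (y' j - z j).natAbs : ℕ) : ℤ) with hD'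
    rw [abs_le] at h
    rw [Finset.mem_sdiff, mem_box_iff_sup_le hd, mem_box_iff_sup_le hd]
    change D' ≤ r' - (2 : ℤ) ^ k ∧ ¬ D' ≤ r' - (2 : ℤ) ^ (k + 2)
    have e1 : (2 : ℤ) ^ k = ((2 ^ k : ℕ) : ℤ) := by push_cast; ring
    have e2 : (2 : ℤ) ^ (k + 2) = ((2 ^ (k + 2) : ℕ) : ℤ) := by push_cast; ring
    have hk1' : ((2 ^ k : ℕ) : ℤ) ≤ m := by exact_mod_cast hk1
    have hk2' : (m : ℤ) < ((2 ^ (k + 1) : ℕ) : ℤ) := by exact_mod_cast hk2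
    have hpow2 : ((2 ^ (k + 2) : ℕ) : ℤ) = 2 * ((2 ^ (k + 1) : ℕ) : ℤ) := by push_cast; ring
    have hs'1z : 4 * (s' : ℤ) ≤ t := by exact_mod_cast hs'1
    have hm1z : 4 * (m : ℤ) ≤ 3 * t := by exact_mod_cast hm1
    have hm2z : 3 * (t : ℤ) < 4 * m + 4 := by exact_mod_cast hm2
    rw [e1, e2]
    constructor <;> omega
  · have hk1' : ((2 ^ k : ℕ) : ℤ) ≤ m := by exact_mod_cast hk1
    have hm1z : 4 * (m : ℤ) ≤ 3 * t := by exact_mod_cast hm1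
    have hs'2z : (t : ℤ) < 4 * s' + 4 := by exact_mod_cast hs'2
    have : ((((r' - D).toNat / 4 : ℕ)) : ℤ) = s' := by rw [hs', htn]
    rw [this]
    omega
  · have hk1' : ((2 ^ k : ℕ) : ℤ) ≤ m := by exact_mod_cast hk1
    have hm1z : 4 * (m : ℤ) ≤ 3 * t := by exact_mod_cast hm1
    omega

/-- **Hence the outer-slope mollifier box has energy at most one band's**: under the hypotheses of `box_outerRadius_subset_band`, for nonneg site weights `c`:
`Σ_{Q_{s′}(y)} c ≤ Σ_{band_k} c` for the `k` it provides. [folklore] -/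
theorem sum_box_outerRadius_le (hd : 0 < d) (z : Zd d) (r' : ℤ) (y : Zd d)
    (ht : 4 ≤ r' - ((Finset.univ.sup fun j => (y j - z j).natAbs : ℕ) : ℤ)) (c : Zd d → ℝ) (hc : ∀ w, 0 ≤ c w) :
    ∃ k : ℕ, ∑ w ∈ box y ((((r' - ((Finset.univ.sup fun j => (y j - z j).natAbs : ℕ) : ℤ)).toNat / 4 : ℕ) : ℤ)), c w ≤
        ∑ w ∈ box z (r' - (2 : ℤ) ^ k) \ box z (r' - (2 : ℤ) ^ (k + 2)), c w ∧
      ((2 ^ k : ℕ) : ℤ) ≤ 2 * (2 * (((r' - ((Finset.univ.sup fun j => (y j - z j).natAbs : ℕ) : ℤ)).toNat / 4 : ℕ) : ℤ) + 1) ∧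
      ((2 ^ k : ℕ) : ℤ) < r' - ((Finset.univ.sup fun j => (y j - z j).natAbs : ℕ) : ℤ) := by
  obtain ⟨k, hsub, h2, h3⟩ := box_outerRadius_subset_band hd z r' y ht
  exact ⟨k, Finset.sum_le_sum_of_subset_of_nonneg hsub fun w _ _ => hc w, h2, h3⟩

end Summit.QuantumFields.YangMills.Theorems.PoincareLipschitzSphereMapBandSuppliers
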